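import Summits.CriticalPhenomena.SAWScalingLimit.Theorems.SAWLoopFugacityFlowAvoidancePassageFinite

/-!
# Outer approximation of a hull subdomain by carved super-domains

Support file for item `stmt-CriticalPhenomena-4984` (`AvoidancePassage`): the planar-topology
input of the '≤' half of the portmanteau sandwich.

* `exists_bite_data` — for `z ∈ D ∖ cl D'` (Dobrushin/Jordan domains `D' ⊆ D` with the marked
  points of `D` on `∂D'`): a bite `B ∋ z` (`…Excursions`, `…Bites`) with its half-disc chart
  (`…Carving`), `B ∩ cl D' = ∅`, open diameter charted into `∂D ∖ cl D'`;
* `exists_superdomain` — **SANDWICH LEMMA**: for every compact `K ⊆ D ∖ cl D'` there is a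
  Dobrushin domain `D''` with the marked points of `D` and a closed set `T` disjoint from `cl D'`
  with `D'' = D ∖ T` (so `D''` contains `D` near `cl D'`, in particular agrees with `D` near the
  marked points) and `D'' ∩ K = ∅`: cover `K` by finitely many bites, deduplicate, carve a charted
  half-disc containing `K ∩ B` off each (`exists_carve_finset`), and re-mark (`…Finite`).

All folklore; no new definitions.
-/

noncomputable section

namespace Summit.CriticalPhenomena.SAWScalingLimit.Theorems.AvoidancePassage

open Set Metric Filter Topology Complex
open UpperHalfPlane (upperHalfPlaneSet isOpen_upperHalfPlaneSet)
open Literature.Topology.PlaneTopology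
open Literature.Probability.RandomPlanarGeometry (JordanDomain DobrushinDomain MarkedDomain)

/-- **Bite data at a point.** For Jordan domains `D' ⊆ D` with two distinct points of `∂D'`
outside `D`, every `z ∈ D ∖ cl D'` lies in a bite `B ⊆ D`, disjoint from `cl D'`, which is one
side of a cross-cut `e ⊆ cl D'` of `D`, charted by a homeomorphism `h` of `ℂ`
(`h(𝔻 ∩ ℍ) = B`) taking the open diameter into `∂D ∖ cl D'`. [folklore] -/
theorem exists_bite_data (D D' : JordanDomain) (hsub : D'.carrier ⊆ D.carrier) {p₁ p₂ : ℂ}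
    (hp₁ : p₁ ∈ frontier D'.carrier) (hp₂ : p₂ ∈ frontier D'.carrier) (hp : p₁ ≠ p₂)
    (hp₁D : p₁ ∉ D.carrier) (hp₂D : p₂ ∉ D.carrier) {z : ℂ} (hzD : z ∈ D.carrier)
    (hz : z ∉ closure D'.carrier) :
    ∃ B : JordanDomain, z ∈ B.carrier ∧ B.carrier ⊆ D.carrier ∧
      Disjoint B.carrier (closure D'.carrier) ∧
      (∃ W e : Set ℂ, IsOpen W ∧ Disjoint B.carrier W ∧ B.carrier ∪ W = D.carrier \ e ∧
        e ⊆ closure D'.carrier) ∧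
      ∃ h : ℂ ≃ₜ ℂ, h '' (ball 0 1 ∩ upperHalfPlaneSet) = B.carrier ∧
        ∀ x : ℝ, |x| < 1 → h x ∈ frontier D.carrier ∧ h x ∉ closure D'.carrier := by
  obtain ⟨u₀, u₁, h01, hlen, hin, h₀, h₁, hzB⟩ :=
    exists_excursion_of_not_mem_closure D D' hsub hp₁ hp₂ hp hp₁D hp₂D hzD hz
  obtain ⟨B, W, s, A, hWo, -, hdisj, hunion, hD'W, hfb, hfw, -, -, hsA, hsAi, hB0, hBh, hBs,
    -⟩ := exists_bite D D' hsub h01 hlen hin h₀ h₁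
  set e := D'.boundary '' Icc u₀ u₁ with he
  have hecl : e ⊆ closure D'.carrier := fun w hw ↦
    frontier_subset_closure (image_Icc_subset_frontier D' hw)
  have heB : e ⊆ frontier B.carrier := hfb ▸ subset_union_left
  have hzmem : z ∈ B.carrier := hzB B.carrier W B.isOpen hWo hdisj hunion hD'W heB
  have hBD : B.carrier ⊆ D.carrier := fun w hw ↦ ((hunion ▸ Or.inl hw : w ∈ D.carrier \ e)).1
  have hWD : W ⊆ D.carrier := fun w hw ↦ ((hunion ▸ Or.inr hw : w ∈ D.carrier \ e)).1
  have hBcl : Disjoint B.carrier (closure D'.carrier) :=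
    disjoint_closure_of_subset_side B.isOpen hdisj hD'W
  have hsF : s ⊆ frontier D.carrier := hsA ▸ subset_union_left
  have heD : e \ {D'.boundary u₀, D'.boundary u₁} ⊆ D.carrier := image_Icc_diff_subset D D' h01 hin
  obtain ⟨h, hh, hhB⟩ := exists_halfDisc_chart B
  refine ⟨B, hzmem, hBD, hBcl, ⟨W, e, hWo, hdisj, hunion, hecl⟩, h, hhB, fun x hx ↦ ?_⟩
  obtain ⟨hxs, hx0, hx1⟩ := chart_ofReal_mem hh hx
  rw [hBs] at hxs
  rw [hB0] at hx0
  rw [hBh] at hx1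
  exact ⟨hsF hxs, not_mem_closure_of_mem_shadow D hWD hfw hsF heD hsAi hD'W hxs hx0 hx1⟩

/-- **SANDWICH LEMMA (outer approximation of a hull subdomain).** Let `D' ⊆ D` be Dobrushin
domains with the same marked points and `K ⊆ D ∖ cl D'` compact. Then there are a Dobrushin
domain `D''` with the marked points of `D` and a closed set `T` disjoint from `cl D'` such that
`D'' = D ∖ T` (as carriers) and `D'' ∩ K = ∅`. [folklore] -/
theorem exists_superdomain (D D' : DobrushinDomain) (hsub : D'.carrier ⊆ D.carrier)
    (h0 : D'.pt 0 = D.pt 0) (h1 : D'.pt 1 = D.pt 1) {K : Set ℂ} (hK : IsCompact K)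
    (hKD : K ⊆ D.carrier) (hKD' : Disjoint K (closure D'.carrier)) :
    ∃ (D'' : DobrushinDomain) (T : Set ℂ), IsClosed T ∧ Disjoint T (closure D'.carrier) ∧
      D''.carrier = D.carrier \ T ∧ D''.pt 0 = D.pt 0 ∧ D''.pt 1 = D.pt 1 ∧
      Disjoint D''.carrier K := by
  classical
  -- the two marked points
  have hab : D.pt 0 ≠ D.pt 1 := fun h ↦ absurd (D.pt_injective h) (by decide)
  have haF' : D.pt 0 ∈ frontier D'.carrier := h0 ▸ D'.pt_mem_frontier 0
  have hbF' : D.pt 1 ∈ frontier D'.carrier := h1 ▸ D'.pt_mem_frontier 1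
  have hnot : ∀ i, D.pt i ∉ D.carrier := fun i hi ↦
    Set.disjoint_left.1 D.disjoint_carrier_frontier hi (D.pt_mem_frontier i)
  -- bite data at every point of `K`
  have hdata : ∀ z : K, ∃ B : JordanDomain, (z : ℂ) ∈ B.carrier ∧ B.carrier ⊆ D.carrier ∧
      Disjoint B.carrier (closure D'.carrier) ∧
      (∃ W e : Set ℂ, IsOpen W ∧ Disjoint B.carrier W ∧ B.carrier ∪ W = D.carrier \ e ∧
        e ⊆ closure D'.carrier) ∧
      ∃ h : ℂ ≃ₜ ℂ, h '' (ball 0 1 ∩ upperHalfPlaneSet) = B.carrier ∧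
        ∀ x : ℝ, |x| < 1 → h x ∈ frontier D.carrier ∧ h x ∉ closure D'.carrier := fun z ↦
    exists_bite_data D.toJordanDomain D'.toJordanDomain hsub haF' hbF' hab (hnot 0) (hnot 1)
      (hKD z.2) fun hz ↦ Set.disjoint_left.1 hKD' z.2 hz
  choose B hzB hBD hBcl hBW h hhB hdiam using hdata
  -- a finite subcover of `K` by bites
  obtain ⟨t, ht⟩ := hK.elim_finite_subcover (fun z : K ↦ (B z).carrier) (fun z ↦ (B z).isOpen)
    fun x hx ↦ mem_iUnion.2 ⟨⟨x, hx⟩, hzB ⟨x, hx⟩⟩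
  have hdich : ∀ i ∈ t, ∀ j ∈ t,
      (B i).carrier = (B j).carrier ∨ Disjoint (B i).carrier (B j).carrier := by
    intro i _ j _
    obtain ⟨W, e, hWo, hd, hu, he⟩ := hBW i
    obtain ⟨W', e', hW'o, hd', hu', he'⟩ := hBW j
    exact eq_or_disjoint_of_sides (B i).isOpen hWo (B j).isOpen hW'o
      (B i).isConnected.isPreconnected (B j).isConnected.isPreconnected (B j).nonempty hd hd'
      hu hu' he he' (hBcl i) (hBcl j)
  -- deduplicate
  obtain ⟨t', ht't, hpair, hcov⟩ := exists_dedupe t (fun i ↦ (B i).carrier) hdich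
  -- radii: `K ∩ B i` is compact, inside a charted smaller half-disc
  have hρ : ∀ i : K, ∃ ρ : ℝ, 0 < ρ ∧ ρ < 1 ∧
      (i ∈ t → K ∩ (B i).carrier ⊆ h i '' (ball 0 ρ ∩ upperHalfPlaneSet)) := by
    intro i
    by_cases hi : i ∈ t
    · have hc : IsCompact (K ∩ (B i).carrier) :=
        isCompact_inter_of_cover hK t (fun j ↦ (B j).carrier) (fun j ↦ (B j).isOpen) ht hdich hi
      obtain ⟨ρ, hρ0, hρ1, hsub'⟩ := exists_lt_one_subset_image (hhB i) hc inter_subset_right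
      exact ⟨ρ, hρ0, hρ1, fun _ ↦ hsub'⟩
    · exact ⟨1 / 2, by norm_num, by norm_num, fun h' ↦ absurd h' hi⟩
  choose ρ hρ0 hρ1 hKρ using hρ
  -- carve
  obtain ⟨J, hJ⟩ := exists_carve_finset D.toJordanDomain B h ρ hρ0 hρ1 hBD hhB
    (fun i x hx ↦ (hdiam i x hx).1) t' hpair
  set T : Set ℂ := ⋃ i ∈ t', h i '' (closedBall 0 (ρ i) ∩ {z : ℂ | 0 ≤ z.im}) with hT
  have hTcl : IsClosed T := by
    refine (Set.Finite.isClosed_biUnion t'.finite_toSet fun i _ ↦ ?_)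
    exact (((isCompact_closedBall (0 : ℂ) (ρ i)).inter_right
      (isClosed_le continuous_const Complex.continuous_im)).image (h i).continuous).isClosed
  have hTD' : Disjoint T (closure D'.carrier) := by
    rw [Set.disjoint_left]
    intro z hz hzcl
    obtain ⟨i, -, hzi⟩ := mem_iUnion₂.1 hz
    rcases mem_image_closedHalfDisc (hρ1 i) hzi with ⟨w, hw1, hwim, rfl⟩ | ⟨x, hx, rfl⟩
    · exact Set.disjoint_left.1 (hBcl i) (chart_mem_carrier (hhB i) hw1 hwim) hzcl
    · exact (hdiam i x hx).2 hzcl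
  -- the marked points are frontier points of `J`
  have hD'J : D'.carrier ⊆ J.carrier := by
    rw [hJ]
    exact fun z hz ↦ ⟨hsub hz, fun hzT ↦ Set.disjoint_left.1 hTD' hzT (subset_closure hz)⟩
  have hfrJ : ∀ i, D.pt i ∈ frontier J.carrier := by
    intro i
    rw [J.isOpen.frontier_eq]
    refine ⟨closure_mono hD'J ?_, fun hi ↦ hnot i (by rw [hJ] at hi; exact hi.1)⟩
    fin_cases i
    · exact frontier_subset_closure haF'
    · exact frontier_subset_closure hbF'
  obtain ⟨E, hE, hE0, hE1⟩ := exists_dobrushinDomain_of_mem_frontier J (hfrJ 0) (hfrJ 1) hab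
  refine ⟨E, T, hTcl, hTD', by rw [hE, hJ], hE0, hE1, ?_⟩
  -- `E ∩ K = ∅`
  rw [hE, hJ, Set.disjoint_left]
  rintro z ⟨-, hzT⟩ hzK
  obtain ⟨j, hj, hzj⟩ := mem_iUnion₂.1 (ht hzK)
  obtain ⟨i, hi, hij⟩ := hcov j hj
  have hzi : z ∈ K ∩ (B i).carrier := ⟨hzK, hij ▸ hzj⟩
  exact hzT (mem_iUnion₂.2 ⟨i, hi, image_halfDisc_subset_image_closed (h i) (ρ i)
    (hKρ i (ht't hi) hzi)⟩)

/-- **Admissibility of the carved super-domain.** If `D'' = D ∖ T` with `T` closed and missing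
the two marked points, then `D''` agrees with `D` in small balls about them. [folklore] -/
theorem exists_ball_inter_eq (D D'' : DobrushinDomain) {T : Set ℂ} (hT : IsClosed T)
    (hcar : D''.carrier = D.carrier \ T) (ha : D.pt 0 ∉ T) (hb : D.pt 1 ∉ T) :
    ∃ ε : ℝ, 0 < ε ∧ D''.carrier ∩ ball (D.pt 0) ε = D.carrier ∩ ball (D.pt 0) ε ∧
      D''.carrier ∩ ball (D.pt 1) ε = D.carrier ∩ ball (D.pt 1) ε := by
  obtain ⟨ε₀, hε₀, hball₀⟩ := Metric.isOpen_iff.1 hT.isOpen_compl _ ha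
  obtain ⟨ε₁, hε₁, hball₁⟩ := Metric.isOpen_iff.1 hT.isOpen_compl _ hb
  refine ⟨min ε₀ ε₁, lt_min hε₀ hε₁, ?_, ?_⟩
  · rw [hcar]
    ext z
    simp only [mem_inter_iff, Set.mem_sdiff]
    constructor
    · rintro ⟨⟨hzD, -⟩, hzb⟩
      exact ⟨hzD, hzb⟩
    · rintro ⟨hzD, hzb⟩
      exact ⟨⟨hzD, hball₀ (ball_subset_ball (min_le_left _ _) hzb)⟩, hzb⟩
  · rw [hcar]
    ext z
    simp only [mem_inter_iff, Set.mem_sdiff]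
    constructor
    · rintro ⟨⟨hzD, -⟩, hzb⟩
      exact ⟨hzD, hzb⟩
    · rintro ⟨hzD, hzb⟩
      exact ⟨⟨hzD, hball₁ (ball_subset_ball (min_le_right _ _) hzb)⟩, hzb⟩

end Summit.CriticalPhenomena.SAWScalingLimit.Theorems.AvoidancePassage

end
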